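import Summits.ResolutionOfSingularities.ResolutionOfSingularities.Theorems.EquisingularLiftEquisingularLiftNatLargeCharSmoothBase
import Mathlib.RingTheory.Localization.Away.Basic
import Mathlib.RingTheory.Localization.Submodule
import Mathlib.RingTheory.Flat.Stability
import Mathlib.RingTheory.Flat.Localization
import Mathlib.RingTheory.FiniteType
import Mathlib.Algebra.CharP.Algebra
import HarnessLib

/-!
# EL♮(3) / EL♮(n), RUNG LC «large characteristic» — brick (B4) WITH THE SHRINK: a smooth `ℤ`-algebra base `B = A[1/a][1/a₀]` inverting a GIVEN
# `a ≠ 0`, flat and Noetherian over the Noetherian domain `A` of characteristic `0`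

leafhand-res-equisingularlift-3 g0 (prover, 2026-08-31; one-generation line-first hand on stmt-ResolutionOfSingularities-20148 / -20038 /
-15660, cell `pub/decomp-res`).  Crux `EquisingularLiftNatThree` (`stmt-…-20148`; uniform in `n`, so also `stmt-…-20038`), line W4.5(b), RUNG LC
(idea-2 g32 `Cruxes/EquisingularLiftNatThree/LARGE-CHAR-RUNG-idea2.md` v1.6 §(B4) «shrink further to `D(a·a₀)` inside the smooth locus of
`Spec A → Spec ℤ` … then `B := A[1/(a a₀)]` is a smooth `ℤ`-algebra»).  ✓ `LargeChar.exists_smooth_away_of_charZero` (…NatLargeCharSmoothBase) gives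
SOME `a₀ ≠ 0` with `A[1/a₀]` smooth over `ℤ`; the door ✓ `exists_forall_descDoorAt_of_K_word_smooth` (…NatLargeCharSpreadDoorSmoothBase) wants a smooth
`ℤ`-algebra `B` which is a Noetherian FLAT `A`-algebra inverting the GIVEN `a ≠ 0` of the spread.  This file supplies that base without any product
bookkeeping: apply (B4) to the domain `A' := A[1/a]` (again of finite type over `ℤ`, characteristic `0`) and take `B := A'[1/a₀]` with Mathlib's tower
instances `A → A' → B`.  DEF-FREE:

* ★ `exists_smooth_away_away` — for a Noetherian domain `A` of characteristic `0`, of finite type over `ℤ`, and `a ≠ 0`: there is `a₀ ≠ 0` in `A[1/a]`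
  such that `B := (A[1/a])[1/a₀]` is SMOOTH over `ℤ`, a FLAT `A`-module (Mathlib `Module.Flat.trans`), `a` is a unit in `B`, and `A → B` is injective
  (so every point `θ : A →+* k` with `θ a ≠ 0` and `θ'(a₀) ≠ 0` factors through `B` — the `f ∉ 𝔭` clause of `hspread`).  `B` is Noetherian by
  Mathlib's instance.

HONEST RESIDUAL of `hspread` (unchanged otherwise): K-side inputs for the universal hypersurface, ✓ `descDoorAt_of_ringHom` bookkeeping of the point,
the N:=1 glue (lh2), the (c3) tying, the binder bookkeeping.  EL♮(3) NOT proved; EL♮ NOT proved; resolution of singularities in positive characteristic NOT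
proved; nothing of [Hironaka2017] (a candidate under adjudication) is asserted or used.  [OURS · bookkeeping · standard axioms · DEF-FREE ·
`--supports stmt-ResolutionOfSingularities-20148 --as helper`, counted 0 · AI-written, weaker than expert review.] [cite: Grothendieck1967, EGA IV₄ 17.5.1] (method; index only)
-/

set_option linter.dupNamespace false -- mandated namespace `Summit.<Summit>.<Problem>` of this single-conjunct summit

noncomputable section

namespace Summit.ResolutionOfSingularities.ResolutionOfSingularities.Cruxes.EquisingularLiftNat.Sections.LargeChar

/-- ★ **(B4) with the shrink** — see the module docstring. [cite: Grothendieck1967, EGA IV₄ 17.5.1] [OURS · L1 W4.5b · RUNG LC (B4); EL♮(3) NOT proved] -/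
theorem exists_smooth_away_away (A : Type) [CommRing A] [IsDomain A] [IsNoetherianRing A] [CharZero A] [Algebra.FiniteType ℤ A]
    (a : A) (ha : a ≠ 0) :
    ∃ a₀ : Localization.Away a, a₀ ≠ 0 ∧
      Algebra.Smooth ℤ (Localization.Away a₀) ∧
      Module.Flat A (Localization.Away a₀) ∧
      IsUnit (algebraMap A (Localization.Away a₀) a) ∧
      Function.Injective (algebraMap A (Localization.Away a₀)) := by
  -- `A' = A[1/a]` is a domain of characteristic zero, of finite type over `ℤ`
  have hle : Submonoid.powers a ≤ nonZeroDivisors A := powers_le_nonZeroDivisors_of_noZeroDivisors ha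
  haveI : IsDomain (Localization.Away a) := IsLocalization.isDomain_localization hle
  have hinjA : Function.Injective (algebraMap A (Localization.Away a)) := IsLocalization.injective (Localization.Away a) hle
  haveI : CharZero (Localization.Away a) := charZero_of_injective_algebraMap hinjA
  haveI : Algebra.FinitePresentation A (Localization.Away a) := IsLocalization.Away.finitePresentation a
  have hft : Algebra.FiniteType ℤ (Localization.Away a) :=
    Algebra.FiniteType.trans (inferInstance : Algebra.FiniteType ℤ A) (inferInstance : Algebra.FiniteType A (Localization.Away a))
  -- the `ℤ`-algebra structure is unique: transport `FiniteType` to whichever instance (B4) elaborates with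
  have hft' : ∀ inst : Algebra ℤ (Localization.Away a), @Algebra.FiniteType ℤ (Localization.Away a) _ _ inst := fun inst => by
    convert hft
    exact Subsingleton.elim _ _
  -- (B4) on `A'`
  obtain ⟨a₀, ha₀, hsm⟩ := @exists_smooth_away_of_charZero (Localization.Away a) _ _ _ (hft' _)
  have hle₀ : Submonoid.powers a₀ ≤ nonZeroDivisors (Localization.Away a) := powers_le_nonZeroDivisors_of_noZeroDivisors ha₀
  have hinj₀ : Function.Injective (algebraMap (Localization.Away a) (Localization.Away a₀)) :=
    IsLocalization.injective (Localization.Away a₀) hle₀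
  have hsm' : Algebra.Smooth ℤ (Localization.Away a₀) := by
    convert hsm <;> first | rfl | exact Subsingleton.elim _ _
  refine ⟨a₀, ha₀, hsm', Module.Flat.trans A (Localization.Away a) (Localization.Away a₀), ?_, ?_⟩
  · rw [IsScalarTower.algebraMap_apply A (Localization.Away a) (Localization.Away a₀)]
    exact (IsLocalization.Away.algebraMap_isUnit a).map _
  · rw [IsScalarTower.algebraMap_eq A (Localization.Away a) (Localization.Away a₀), RingHom.coe_comp]
    exact hinj₀.comp hinjA

end Summit.ResolutionOfSingularities.ResolutionOfSingularities.Cruxes.EquisingularLiftNat.Sections.LargeChar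

end
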